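import Summits.CriticalPhenomena.PercolationContinuityZ3.Theorems.PercNearOneGluingNoHeavyQuantLowToZeroIncome
import Summits.CriticalPhenomena.PercolationContinuityZ3.Theorems.PercNearOneGluingNoHeavyQuantGateMoveBlobCorner
import HarnessLib

/-!
# QUANT lane R8, T-DEC, leg (III): the blob gate move (M) from the CORNER datum in INCOME form — one aggregated inequality on the
# corner leftovers below the blob (typer g28, part 6)

builds on p205010 (kernel theorem, internal audit signed; external expert review pending)

Support file (`--supports stmt-CriticalPhenomena-4575`), QUANT lane typer seat prim-quant-stmt (gen 28), rung R8 of
`run/shared/lean/prim/quant/LADDER.md`.  Theorems only, standard axioms, no sorries, no definitions.  Parts 1–5: `…QuantLowToZeroMove`,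
`…QuantGateMoveBlobDatum`, `…QuantGateMoveBlobCorner`, `…QuantLowToZeroMoveMid`, `…QuantLowToZeroRouting`, `…QuantLowToZeroIncome`.

* **`LawDec.flowAtT_gateMoveBlob_of_corner_income`** — typer g27's setting of (M) with the blob atom `a` a `t`-low (`a ≤ j < M + a`,
  `2a < t = S + ag − zag`), hypothesis `slice ν a g ∈ D_y(S + ag, j)`, and — in place of `hsupp` / part 3's `hk` — the AGGREGATED INCOME
  INEQUALITY on the corner run of the slice: `Σ_{0<k<a, 2k<t} k·leftover(k)⁺ ≤ Σ_{t-mids h<t} (t−h)·Λ h + Σ_{giants h} Λ h·(t−yh)/y`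
  (`Λ = slice ν a g`; position-weighted corner leftovers of the unshifted atoms below the blob ≤ low-mid income + giant slack).  Conclusion:
  the moved law is `FlowAtT` at `(y, t, j)`.  Part 3's `flowAtT_gateMoveBlob_of_corner` is the case where the left side vanishes.  The residual
  (R1) of (M) is now ONE explicit inequality on ν; memo `run/shared/lean/prim/quant/prim-quant-stmt-g28/GATE-MOVE-G28.md` §6/§8: in every
  exact test the left side is paid by "giant slack + twins" (`Λ(k+a) ≥ g·ν(k)`); proving that bound closes (M) for every `t`-low blob atom.
HONEST STATUS: (M) ∀ a, `GateMove`, `GatedConvEmptyFree`, `SingleGateConvClosed`, `SDECConvClosed`, `TreeDEC`, `FarTreeRow` remain OPEN.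

[this work]; income criterion arm-1 g39 (p333825), corner run typer g23 / lead g21–g23, (M) typer g27 (this lane).  The gluing rows served
[cite: KozmaNitzan2024, Conjecture 3 (p. 15)]; product measure [cite: Grimmett1999, §1.3 p. 10].
-/

noncomputable section

namespace Summit.CriticalPhenomena.PercolationContinuityZ3.Theorems

namespace Quant

open Finset

namespace LawDec

/-! ### (M) from the corner datum under the aggregated income inequality -/

/-- **THE BLOB GATE MOVE FROM THE CORNER DATUM, INCOME FORM (`a` a `t`-low).**  Setting of `flowAtT_gateMoveBlob_of_corner`
(typer g28 part 3) with the residual hypothesis `hk` replaced by the AGGREGATED INCOME INEQUALITY on the corner run of the slice at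
`(y, S + ag, j)`: the position-weighted corner leftovers of the unshifted atoms strictly between `0` and `a` (that are `t`-lows) are at
most the low-mid income plus the giant slack of the moved law (which agrees with the slice off `{0, a}`),
`Σ_{0<k<a, 2k<t} k·leftover(k) ≤ Σ_{t-mids h<t} (t−h)·Λ h + Σ_{giants} Λ h·(t−yh)/y`, `Λ = slice ν a g`.  Then the moved law has a flow at `(y, t, j)`.
Proof: corner witness as datum; if `a` keeps a leftover `≥ gz`, part 2's first branch; otherwise no low above `a` keeps a leftover
(part 3's `cornerLeftover_eq_of_leftover_above`), so the giant-bound masses of the datum are exactly those leftovers below `a`, and part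
5b's `flowAtT_lowToZero_of_income` finishes.  (`hk` of part 3 is the case where the left side vanishes; memo GATE-MOVE-G28 §6/§8: the left
side is paid by "GS + twins" in every exact test — the remaining (R1) inequality.) [this work] -/
theorem flowAtT_gateMoveBlob_of_corner_income (y z g S : ℝ) (a j M : ℕ) (ν : ℕ → ℝ)
    (hy0 : 0 < y) (hy1 : y < 1) (hz0 : 0 ≤ z) (hg1 : g ≤ 1) (hyg : y ≤ (1 - z) * g) (ha : 1 ≤ a)
    (hν0 : ∀ h, 0 ≤ ν h) (hνM : ∀ h, M < h → ν h = 0) (hν1 : ∑ h ∈ Finset.range (M + 1), ν h = 1)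
    (hS : S = ∑ h ∈ Finset.range (M + 1), (h : ℝ) * ν h) (hta : y * (M : ℝ) ≤ S) (hzν : z ≤ ν 0)
    (hjN : j < M + a) (haj : a ≤ j) (hat : 2 * (a : ℝ) < S + (a : ℝ) * g - z * (a : ℝ) * g)
    (hΛ : DECAtT y (S + (a : ℝ) * g) j (M + a) (slice ν a g))
    (hinc : ∑ k ∈ Finset.range (j + 1),
        (if (1 ≤ k ∧ 2 * (k : ℝ) < S + (a : ℝ) * g - z * (a : ℝ) * g ∧ k < a) then
          (k : ℝ) * max (cornerLeftover y (S + (a : ℝ) * g) j (M + a) (slice ν a g) k) 0 else 0)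
      ≤ ∑ h ∈ Finset.range (j + 1),
          (if ((S + (a : ℝ) * g - z * (a : ℝ) * g) ≤ 2 * (h : ℝ) ∧ (h : ℝ) < S + (a : ℝ) * g - z * (a : ℝ) * g) then
            ((S + (a : ℝ) * g - z * (a : ℝ) * g) - (h : ℝ)) * slice ν a g h else 0)
        + ∑ h ∈ Finset.Ico (j + 1) (M + a + 1),
          slice ν a g h * ((S + (a : ℝ) * g - z * (a : ℝ) * g) - y * (h : ℝ)) / y) :
    FlowAtT y (S + (a : ℝ) * g - z * (a : ℝ) * g) j (M + a)
      (fun h => slice ν a g h + g * z * ((if h = 0 then (1 : ℝ) else 0) - (if h = a then (1 : ℝ) else 0))) := by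
  set τ : ℝ := S + (a : ℝ) * g with hτ
  set t : ℝ := S + (a : ℝ) * g - z * (a : ℝ) * g with ht
  set Λ : ℕ → ℝ := slice ν a g with hΛdef
  have hz1 : z ≤ 1 := by
    have h0 := Finset.single_le_sum (fun h _ => hν0 h) (Finset.mem_range.2 (Nat.succ_pos M))
    rw [hν1] at h0
    exact hzν.trans h0
  have hg0 : 0 < g := by
    by_contra hc
    have : (1 - z) * g ≤ 0 := mul_nonpos_of_nonneg_of_nonpos (by linarith) (not_lt.1 hc)
    linarith
  have ha0 : (0 : ℝ) < a := by exact_mod_cast ha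
  have hzag : 0 ≤ z * (a : ℝ) * g := mul_nonneg (mul_nonneg hz0 ha0.le) hg0.le
  have htτ : t ≤ τ := by rw [ht, hτ]; linarith
  have haτ : 2 * (a : ℝ) < τ := lt_of_lt_of_le hat htτ
  have htaN : y * ((M + a : ℕ) : ℝ) ≤ t := by
    rw [ht]; push_cast
    have : y * (a : ℝ) ≤ (1 - z) * g * a := mul_le_mul_of_nonneg_right hyg ha0.le
    nlinarith
  have hΛ0 : ∀ h, 0 ≤ Λ h := fun h => slice_nonneg ν a g hg0.le hg1 hν0 h
  have hgzΛa : g * z ≤ Λ a := by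
    show g * z ≤ slice ν a g a
    rw [slice_apply_self]; nlinarith [hν0 a, mul_le_mul_of_nonneg_left hzν hg0.le]
  obtain ⟨hP0, hPM, hP1, hPt⟩ := moved_laws ν a M g z ha hg0.le hg1 hz0 hzν hν0 hνM hν1
  have hPt' : ∑ h ∈ Finset.range (M + a + 1),
      (h : ℝ) * (slice ν a g h + g * z * ((if h = 0 then (1 : ℝ) else 0) - (if h = a then (1 : ℝ) else 0))) = t := by
    rw [hPt, ← hS, ht]
  -- the corner witness
  have hC : CornerSucceeds y τ j (M + a) Λ :=
    cornerSucceeds_of_flowAtT y τ j (M + a) Λ hy0 hy1 hΛ0 (flowAtT_of_decAtT y τ j (M + a) Λ hy0 hy1 hΛ)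
  have hf : IsFlowAtT y τ j (M + a) Λ (cornerWitness y τ j (M + a) Λ) := isFlowAtT_cornerWitness y τ j (M + a) Λ hy0 hy1 hΛ0 hC
  obtain ⟨-, -, hrow, -⟩ := cornerFlow_inv y τ j (M + a) Λ hy0 hy1 hΛ0 ((j + 1) * (j + 1)) le_rfl
  have hleft0 : ∀ l, 0 ≤ cornerLeftover y τ j (M + a) Λ l := by
    intro l; unfold cornerLeftover cornerMidFlow; linarith [hrow l]
  by_cases hGa : g * z ≤ ∑ h ∈ Finset.Ico (j + 1) (M + a + 1), cornerWitness y τ j (M + a) Λ a h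
  · exact flowAtT_lowToZero_of_giantBound y τ t (g * z) a j (M + a) Λ _ hy0 hy1 htτ (mul_nonneg hg0.le hz0) haj hat hΛ0 hf hGa
  have hGa' := (not_le.1 hGa).le
  -- the giant part of every row of the corner witness is at most its leftover, and vanishes above `a`
  have hgiant_le : ∀ l, l ≤ j → 2 * (l : ℝ) < τ →
      ∑ h ∈ Finset.Ico (j + 1) (M + a + 1), cornerWitness y τ j (M + a) Λ l h ≤ cornerLeftover y τ j (M + a) Λ l := by
    intro l hl hlow
    by_cases hG : (∑ h ∈ Finset.Ico (j + 1) (M + a + 1), Λ h) = 0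
    · have : ∑ h ∈ Finset.Ico (j + 1) (M + a + 1), cornerWitness y τ j (M + a) Λ l h = 0 :=
        Finset.sum_eq_zero fun h hh => by
          unfold cornerWitness
          rw [cornerMidFlow_eq_zero_of y τ j (M + a) Λ hy0 hy1 hΛ0 l h (Or.inr (by have := (Finset.mem_Ico.1 hh).1; omega)),
            zero_add, if_pos hG]
          ring
      rw [this]; exact hleft0 l
    · rw [cornerWitness_giant_sum y τ j (M + a) Λ hy0 hy1 hΛ0 l hl hlow hG]
  have hgiant_above : ∀ l h, 1 ≤ l → a < l → l ≤ j → 2 * (l : ℝ) < t → j + 1 ≤ h → cornerWitness y τ j (M + a) Λ l h = 0 := by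
    intro l h hl1 hal hlj hlt hh
    apply cornerWitness_giant_eq_zero y τ j (M + a) Λ l h hh hy0 hy1 hΛ0
    by_contra hne
    have hpos : 0 < cornerLeftover y τ j (M + a) Λ l := lt_of_le_of_ne (hleft0 l) (Ne.symm hne)
    apply hGa
    by_cases hG : (∑ h ∈ Finset.Ico (j + 1) (M + a + 1), Λ h) = 0
    · -- no giant mass: the certificate forces every leftover to vanish — contradiction with `hpos`
      exfalso
      have h1x : 0 < 1 - y := by linarith
      unfold CornerSucceeds at hC
      rw [hG] at hC
      have hsum0 : ∑ l' ∈ (Finset.range (j + 1)).filter (fun l' : ℕ => 2 * (l' : ℝ) < τ), cornerLeftover y τ j (M + a) Λ l' ≤ 0 := by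
        have := div_pos hy0 h1x
        by_contra hc
        push Not at hc
        have := mul_pos (div_pos hy0 h1x) hc
        linarith
      have hmem : l ∈ (Finset.range (j + 1)).filter (fun l' : ℕ => 2 * (l' : ℝ) < τ) :=
        Finset.mem_filter.2 ⟨Finset.mem_range.2 (Nat.lt_succ_of_le hlj), by linarith⟩
      have := Finset.single_le_sum (fun l' _ => hleft0 l') hmem
      linarith
    · rw [cornerWitness_giant_sum y τ j (M + a) Λ hy0 hy1 hΛ0 a haj haτ hG,
        cornerLeftover_eq_of_leftover_above y τ j (M + a) Λ hy0 hy1 hΛ0 l a hlj (by linarith) hal hpos]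
      exact hgzΛa
  -- the aggregated inequality for the corner datum
  refine flowAtT_lowToZero_of_income y τ t (g * z) a j (M + a) Λ _ hy0 hy1 htτ haj hat hjN hΛ0 hf hgzΛa hP0 hP1 hPt' htaN
    hGa' (le_trans (Finset.sum_le_sum fun k hk => ?_) hinc)
  have hkj : k ≤ j := Nat.lt_succ_iff.1 (Finset.mem_range.1 hk)
  by_cases hc : 1 ≤ k ∧ 2 * (k : ℝ) < t ∧ k ≠ a
  · rw [if_pos hc]
    rcases lt_or_gt_of_ne hc.2.2 with hka | hak
    · rw [if_pos ⟨hc.1, hc.2.1, hka⟩]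
      refine mul_le_mul_of_nonneg_left ?_ (Nat.cast_nonneg k)
      exact le_trans (hgiant_le k hkj (by linarith [hc.2.1])) (le_max_left _ _)
    · rw [if_neg (fun h' => by omega)]
      have : ∑ h ∈ Finset.Ico (j + 1) (M + a + 1), cornerWitness y τ j (M + a) Λ k h = 0 :=
        Finset.sum_eq_zero fun h hh => hgiant_above k h hc.1 hak hkj hc.2.1 (Finset.mem_Ico.1 hh).1
      rw [this, mul_zero]
  · rw [if_neg hc]
    by_cases hc2 : 1 ≤ k ∧ 2 * (k : ℝ) < t ∧ k < a
    · rw [if_pos hc2]; exact mul_nonneg (Nat.cast_nonneg k) (le_max_right _ _)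
    · rw [if_neg hc2]

end LawDec

end Quant

end Summit.CriticalPhenomena.PercolationContinuityZ3.Theorems
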